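import Summits.QuantumFields.YangMills.Theorems.BalabanUVNodesN13DensityOfRecordIsAveragedGibbsMeasureAtRecord13SepCoPH
import Summits.QuantumFields.YangMills.Theorems.BalabanUVNodesN13NodeOfIteratedTransportUVAtRecord13SepCoPH
import Summits.QuantumFields.YangMills.Theorems.BalabanUVNodesN13Cor3AEKeepZeroOfEnginesRowAtRecord13

/-!
# BalabanUVNodes ∕ N13 — N13's ENGINE ROW IN THE `dV`-A.E. CURRENCY AND K1's (B) UP TO AN A.E. RE-CHOICE, PRICED BY ONE INEQUALITY BETWEEN MEASURES:
# `(avg_{k−1}∘⋯∘avg_0)_*(ρ₀·dU_0) ≤ e^{ep(g_k)|T₁^{(k)}|}·Haar_k` on the windowed runs (ultraviolet stability of the block-averaged Wilson–Gibbs MEASURE) + (L2ˢ)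
# (Track A, DAG node N13 = [B16]; cluster K1 — K1⁸ `StabilityBRunRowsAtRecordR13SepCoPH` = stmt-QuantumFields-26907 (K1⁷ 20542 aside), helper; seat `pub-ymgap-dag-n13-w3` g4, sequel of
# `…N13DensityOfRecordIsAveragedGibbsMeasureAtRecord13SepCoPH` (F12) and p618747 (F11); consumes dag-n13-w2's p619268 ∕ p621421 and DEF-1's p620607 by name; 2026-08-28; count-neutral)

HONEST FRAMING.  Count-neutral BY-NAME JUNCTION; nothing of Bałaban's is asserted or refuted.  Director-ym №210 (INBOX l.32415, on plan g84 WORD-3 ∕ 3b): the Cor-3 half (levels ≥ 1) of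
K1⁸'s (B) conjunct AS TYPED is decided by density VERSIONS; repair (δ) = a.e.-currency display + datum surgery; INTERIM (5): «Cor-3 suppliers at levels ≥ 1 land in VERSION-FREE currency
(a.e. ∕ measure ∕ integrated)»; dag-n13-w2's p619268 §3 typed the CONSUMER: Theorem 1 at the datum + the engines' N13 row `hUV` with «every `U`» replaced by «`dV`-a.e. `U`» ⟹ densities
`ρ′ =ᵐ ρ` carrying `B16.EndStatementBPrinted` AS TYPED.  THIS FILE supplies that a.e. row from the MEASURE currency of F12:
* §0 `towerMeasure_le_iff_ae_densOfRecord₁₃_le` — under the selector laws the measure row «`(π_k)_*(ρ₀·dU_0) ≤ ofReal B · Haar_k` on measurable sets» IS the `dV`-a.e. upper bound `ρ_k ≤ B`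
  (F12 §3 + §1); `towerMeasure_le_of_iterTransport_le` — p618747's everywhere row `I_k ≤ B` on the VERSION implies it (F12 §2 + §1): the measure row is the weaker, version-free input.
  `integral_rhoZero_le_of_towerMeasure_le` — the INTEGRATED face: the row at level `k` on `S = univ` is the partition-function bound `∫ρ₀ dU_0 = e^{−E(P)}·Z(g₀) ≤ e^{ep(g_k)|T₁^{(k)}|}`.
* §1 ★★★ `aeRow₁₃SepCoPH_of_selLaws_towerMeasureUV_L2small` — p619268's `hrow`, LETTER FOR LETTER, ⟸ `Provisos₁₃SepCoPH` ∧ the tree's selector laws (i)(ii) ∧ ONE MEASURE INEQUALITY `hμUV`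
  «`(π_k)_*(ρ₀·dU_0)(S) ≤ ofReal (e^{ep(g_k)|T₁^{(k)}|}) · Haar_k(S)` for every measurable `S`, on the `γ`-windowed runs, `k ≤ K`» ∧ (L2ˢ) ∧ `hε hε3 hε2`.  UPPER half a.e. by F12 §3 (`ρ_k·dV_k` IS
  that measure) + F12 §1's currency lemma; LOWER half everywhere by dag-n13-w1's `uvLower_of_smallLocus`.  Compared with p618747 §1 (`hIUV` everywhere on the VERSION `I_k`, plus `hmeas`, plus
  the boundedness bookkeeping): NO density version, NO everywhere bound, NO measurability row is read — the analytic input is an inequality between two measures on `SU(N)^{bonds}`.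
* §2 ★★★ `exists_rho_ae_eq_endStatementBPrinted_datum_of_thm1_of_towerMeasureUV_L2small` — Theorem 1 at K1's literal datum + §1's inputs ⟹ `∃ ρ′, (∀ P k, ρ′ P k =ᵐ[dV] ρ_k) ∧
  B16.EndStatementBPrinted (fun P => {(datum).C P with ρ := ρ′ P})` (p619268 fed with §1); ★★★ `…_of_tRow_selLaws_towerMeasureUV_L2small` — the same with Theorem 1 from N11's T-row + the
  selector laws (p583899's `thm1Printed_datumOfRecord₁₃SepCoPH_of_laws_of_selLaws`).  = the B16-level half of plan g84 WORD-3b's (δⱽ) VERSION SLOT, priced VERSION-FREE; the datum ∕ rung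
  transfer (`Tower.revise`, `Revision₁₃`, `datumⱽ`) is the definers' (DEF-1 ∕ def-T) and dag-n13-w1's, untouched here.
* §3 ★★★ `exists_revision₁₃_endStatementBPrinted_of_thm1_of_row0_of_towerMeasureUV_of_aeLowerSmall` — THE K1⁹ (B)-SLOT LETTER `∃ v : Revision₁₃ F N θ h, B16.EndStatementBPrinted
  (datumOfRecord₁₃SepCoPHV F N θ h v).C` (DEF-1's p620607 objects) ⟸ Theorem 1 + the level-0 row + laws (i)(ii) + `hμUV` at levels `k+1 ≤ K` + the `dV`-a.e. (Lˢ) half — dag-n13-w2's p621421 §4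
  `exists_revision₁₃_endStatementBPrinted_of_thm1_of_row0_of_aeUpper_of_aeLowerSmall` with `hupper` DISCHARGED from the measure inequality by §0.
WHAT IS DISPLAYED AND WHERE IT SITS IN PRINT (LOCATED, by name): `hμUV` is (2.50)'s upper half for the UNRENORMALISED `k`-fold averaged Gibbs measure — Bałaban's ultraviolet stability proper
at the tree's selector laws ([B16] Thm 1 ∕ [IV] reach it for 𝐑-renormalised densities through the history-mixing 𝐑, (0.3) with nontrivial `Z′`, which law (ii) does not exercise —
p615170); (L2ˢ) = [III] Thm 2 ∕ (2.49) at the all-small history; N11's T-row and the selector laws as in p604459 ∕ p610463 ∕ p618747.  (U1) NOT proved; Cor. 3 NOT proved; N13 NOT discharged;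
K0⁷ ∕ K1⁸ NOT closed; no stub closed; counts unmoved (typed 28∕28 · discharged 5∕27 · Track A 5∕28).  ONE finite four-torus programme at fixed `ε = L^{−K}`, Bałaban AS PRINTED; R4 closes the
conditional finite-𝕋⁴ rung `BalabanLadder.UV` only — the Yang–Mills mass gap (Clay) is NOT proved by any of this; nothing continuum ∕ ℝ⁴ ∕ OS.  No `sorry`, `def`, `instance`, `notation`.

Sources: [Balaban1988Convergent] p.245, (2.18) p.257, Thm 1 p.262, Thm 2 p.263, (2.49) + Cor. 3 (2.50) p.264, (3.1) p.264; [Balaban1989LargeFieldI] abstract, p.175, (0.2)–(0.4) p.176,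
(i)–(ii) p.177; [Balaban1989LargeFieldII] Thm 1 + (0.1) pp.355–356, p.391; [Balaban1985Averaging] Prop. 2 (54) p.26.
-/

noncomputable section

open MeasureTheory
open scoped BigOperators ENNReal Matrix.Norms.L2Operator

namespace Summit.QuantumFields.YangMills.BalabanUVNodes.N13AERowOfAveragedGibbsMeasureBoundAtRecord13SepCoPH

open Literature.MathematicalPhysics.QuantumFieldTheory.Balaban1983to89
open T4Continuum Node00 B14.Eq218Concrete
open Summit.QuantumFields.YangMills.BalabanUVNodes.N13DensityOfRecordIsAveragedGibbsMeasureAtRecord13SepCoPH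
  (ae_le_iff_withDensity_le densOfRecord₁₃_nonneg withDensity_densOfRecord₁₃_eq_map_tower_of_selLaws)

/-! ## §0. The measure row at the record: EQUIVALENT to the `dV`-a.e. upper bound on `ρ_k` (laws (i)(ii)); IMPLIED by p618747's everywhere row `hIUV` on the version `I_k` -/

section Currency

variable (F : T4Family) (N : ℕ) [NeZero N] (θ : Stage13HParams F N) (P : B12.RunParams)

open Summit.QuantumFields.YangMills.BalabanUVNodes.N13DensityOfRecordIsAveragedGibbsMeasureAtRecord13SepCoPH (map_tower_rhoZero_eq_withDensity_iterTransport)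
open Summit.QuantumFields.YangMills.BalabanUVNodes.N13DensityBelowIteratedTransportOfDeadSelAtRecord13CoPH (iterTransport_measurable_nonneg)

open Classical in
/-- **THE MEASURE ROW ⟺ THE `dV`-A.E. UPPER BOUND ON THE DENSITY OF RECORD** (under `Provisos₁₃SepCoPH` and the selector laws (i)(ii) at the levels `≤ k`, any `B ≥ 0`):
`(∀ S measurable, (π_k)_*(ρ₀·dU_0)(S) ≤ ofReal B · Haar_k(S)) ↔ (∀ᵐ V ∂dV_k, ρ_k(V) ≤ B)` — F12 §3 (`ρ_k·dV_k` IS that measure) + F12 §1's currency lemma.  So the measure row is EXACTLY the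
a.e. upper half of (2.50) for the density of record, stated without any density. [cite: Balaban1988Convergent, Cor. 3 (2.50) p.264; Balaban1989LargeFieldI, (0.3) p.176, (i)–(ii) p.177 (bookkeeping)] -/
theorem towerMeasure_le_iff_ae_densOfRecord₁₃_le (h : θ.Provisos₁₃SepCoPH F N) (k : ℕ) (hk : k ≤ P.K)
    (hidem : ∀ j, j < k → ∀ a : SeqOfRecord F θ.ν θ.τ9.M (gOfRecord₁₃ F N θ.toStage13Params P) P.K (j + 1),
      θ.ppSel P (gOfRecord₁₃ F N θ.toStage13Params P) (j + 1) (θ.ppSel P (gOfRecord₁₃ F N θ.toStage13Params P) (j + 1) a)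
        = θ.ppSel P (gOfRecord₁₃ F N θ.toStage13Params P) (j + 1) a)
    (hdead : ∀ j, j < k → ∀ a : SeqOfRecord F θ.ν θ.τ9.M (gOfRecord₁₃ F N θ.toStage13Params P) P.K (j + 1), θ.ppSel P (gOfRecord₁₃ F N θ.toStage13Params P) (j + 1) a ≠ a →
      ∀ V, B15.BasicStep.fibreIntegral (fibOfSeq F θ.ν θ.τ9 P (gOfRecord₁₃ F N θ.toStage13Params P) (j + 1) a)
        (rterm (sliceOfRecord F N θ.ν θ.τ9.M P (gOfRecord₁₃ F N θ.toStage13Params P) (j + 1)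
          (slotsTOfRecord F N θ.ν θ.τ9 (EOfRecord₁₃ F N θ.toStage13Params) (wOfRecord₉ F N θ.toStage9Params) θ.ppSel P (gOfRecord₁₃ F N θ.toStage13Params P) (j + 1))) a) V = 0)
    (B : ℝ) (hB : 0 ≤ B) :
    (∀ S : Set (GaugeField (F.P P.K) k (SU N)), MeasurableSet S →
      ((fieldMeasure (F.P P.K) 0 (SU N)).withDensity fun U =>
          ENNReal.ofReal (rhoZeroOfRecord F N P.K (gOfRecord₁₃ F N θ.toStage13Params P 0) (EOfRecord₁₃ F N θ.toStage13Params P) U)).map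
        (Nat.rec (motive := fun j => GaugeField (F.P P.K) 0 (SU N) → GaugeField (F.P P.K) j (SU N)) id (fun j π => (avOfRecord F N P.K j).avg ∘ π) k) S ≤
      ENNReal.ofReal B * fieldMeasure (F.P P.K) k (SU N) S) ↔
    ∀ᵐ V ∂(fieldMeasure (F.P P.K) k (SU N)), densOfRecord₁₃ F N θ.toStage13Params P k V ≤ B := by
  have hρi : Integrable (densOfRecord₁₃ F N θ.toStage13Params P k) (fieldMeasure (F.P P.K) k (SU N)) :=
    isIntegrable_towerOfRecord₁₃SepCoPH F N θ h P k hk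
  rw [ae_le_iff_withDensity_le hρi.1.aemeasurable (ae_of_all _ fun U => densOfRecord₁₃_nonneg F N θ P h.toCore k U) B hB,
    withDensity_densOfRecord₁₃_eq_map_tower_of_selLaws F N θ P h k hk hidem hdead]

open Classical in
/-- **p618747's EVERYWHERE ROW ON THE VERSION `I_k` IMPLIES THE MEASURE ROW** (every Stage-13 parameter, NO proviso, NO selector law; `k ≤ K`): `(∀ V, I_k(V) ≤ B) ⟹ ∀ S measurable,
(π_k)_*(ρ₀·dU_0)(S) ≤ ofReal B · Haar_k(S)` — F12 §2 (`(π_k)_*(ρ₀·dU_0) = I_k·dV_k`) + F12 §1.  The measure row is thus the WEAKER input: it forgets the version and keeps the a.e. class.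
[cite: Balaban1988Convergent, Thm 1 p.262, Cor. 3 (2.50) p.264, (3.1) p.264 (bookkeeping)] -/
theorem towerMeasure_le_of_iterTransport_le (k : ℕ) (hk : k ≤ P.K) (B : ℝ)
    (hIUV : ∀ V : GaugeField (F.P P.K) k (SU N),
      Nat.rec (motive := fun j => GaugeField (F.P P.K) j (SU N) → ℝ)
        (rhoZeroOfRecord F N P.K (gOfRecord₁₃ F N θ.toStage13Params P 0) (EOfRecord₁₃ F N θ.toStage13Params P))
        (fun j I => transportOfRecord F N P.K j I) k V ≤ B) :
    ∀ S : Set (GaugeField (F.P P.K) k (SU N)), MeasurableSet S →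
      ((fieldMeasure (F.P P.K) 0 (SU N)).withDensity fun U =>
          ENNReal.ofReal (rhoZeroOfRecord F N P.K (gOfRecord₁₃ F N θ.toStage13Params P 0) (EOfRecord₁₃ F N θ.toStage13Params P) U)).map
        (Nat.rec (motive := fun j => GaugeField (F.P P.K) 0 (SU N) → GaugeField (F.P P.K) j (SU N)) id (fun j π => (avOfRecord F N P.K j).avg ∘ π) k) S ≤
      ENNReal.ofReal B * fieldMeasure (F.P P.K) k (SU N) S := by
  obtain ⟨hI, hmap⟩ := map_tower_rhoZero_eq_withDensity_iterTransport F N θ P k hk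
  have h0 := (iterTransport_measurable_nonneg F N θ P k).2
  have hB : 0 ≤ B := by
    have W : GaugeField (F.P P.K) k (SU N) := fun _ => 1
    exact (h0 W).trans (hIUV W)
  rw [hmap]
  exact (ae_le_iff_withDensity_le hI.1.aemeasurable (ae_of_all _ h0) B hB).1 (ae_of_all _ hIUV)


open Summit.QuantumFields.YangMills.BalabanUVNodes.N13DensityOfRecordIsAveragedGibbsMeasureAtRecord13SepCoPH (integrable_rhoZeroOfRecord measurable_iterAvgOfRecord) in
/-- **THE INTEGRATED FACE OF THE MEASURE ROW — THE PARTITION-FUNCTION BOUND** (every Stage-13 parameter, NO proviso): the measure row at ONE level `k` tested on `S = univ` IS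
`∫ ρ₀ dU_0 ≤ e^{B}`-type: `(π_k)_*(ρ₀·dU_0)(univ) = ofReal (∫ ρ₀ dU_0)` (the averaged measure keeps the mass `e^{−E(P)}·Z_{T^{(0)}}(g₀)`; product Haar is a probability measure), so
`(∀ S, (π_k)_*(ρ₀·dU_0)(S) ≤ ofReal B · Haar_k(S)) ⟹ ∫ ρ₀ dU_0 ≤ B` — at `B = e^{ep(g_k)|T₁^{(k)}|}` the row CONTAINS the normalisation statement «`e^{−E(P)}·Z(g₀) ≤ e^{E₊|T₁^{(k)}|}`» of [III] Thm 1's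
constant `E` (the integrated currency; at `k = K` a number per run, `|T₁^{(K)}| = (2L^m)⁴`).  LOCATED, count-neutral. [cite: Balaban1988Convergent, Thm 1 p.262, (1.15) p.249, Cor. 3 (2.50) p.264 (bookkeeping)] -/
theorem integral_rhoZero_le_of_towerMeasure_le (k : ℕ) {B : ℝ} (hB : 0 ≤ B)
    (hμ : ∀ S : Set (GaugeField (F.P P.K) k (SU N)), MeasurableSet S →
      ((fieldMeasure (F.P P.K) 0 (SU N)).withDensity fun U =>
          ENNReal.ofReal (rhoZeroOfRecord F N P.K (gOfRecord₁₃ F N θ.toStage13Params P 0) (EOfRecord₁₃ F N θ.toStage13Params P) U)).map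
        (Nat.rec (motive := fun j => GaugeField (F.P P.K) 0 (SU N) → GaugeField (F.P P.K) j (SU N)) id (fun j π => (avOfRecord F N P.K j).avg ∘ π) k) S ≤
      ENNReal.ofReal B * fieldMeasure (F.P P.K) k (SU N) S) :
    ∫ U, rhoZeroOfRecord F N P.K (gOfRecord₁₃ F N θ.toStage13Params P 0) (EOfRecord₁₃ F N θ.toStage13Params P) U ∂fieldMeasure (F.P P.K) 0 (SU N) ≤ B := by
  have h := hμ Set.univ MeasurableSet.univ
  rw [Measure.map_apply (measurable_iterAvgOfRecord F N P.K k) MeasurableSet.univ, Set.preimage_univ, withDensity_apply _ MeasurableSet.univ,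
    Measure.restrict_univ, measure_univ, mul_one,
    ← ofReal_integral_eq_lintegral_ofReal (integrable_rhoZeroOfRecord F N P.K _ _) (ae_of_all _ fun U => (rhoZeroOfRecord_pos F N P.K _ _ U).le)] at h
  exact (ENNReal.ofReal_le_ofReal_iff hB).1 h

end Currency

/-! ## §1. ★★★ THE CURRENCY: N13's engine row in the `dV`-a.e. letters of p619268 from ONE MEASURE INEQUALITY on the averaged Gibbs measures + (L2ˢ) -/

section Row

variable (F : T4Family) (N : ℕ) [NeZero N] (θ : Stage13HParams F N) (h : θ.Provisos₁₃SepCoPH F N)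

open ExpMeanLog (deltaSU)
open Summit.QuantumFields.YangMills.BalabanUVNodes.N13Cor3Repr218LeavesAtRecord13CoPH (densOfRecord₁₃_eq_sum)
open Summit.QuantumFields.YangMills.BalabanUVNodes.N13UVChiOffSolvableAtRecord13 (histTerm_nonneg uvLower_of_smallLocus)
open Summit.QuantumFields.YangMills.BalabanUVNodes.N13UVRowOfUpperAndSmallLocus (le_m_add_K_of_le)

open Classical in
/-- **★★★ THE ENGINES' N13 ROW IN THE `dV`-A.E. CURRENCY (p619268 §3's `hrow`, letter for letter) FROM ONE MEASURE INEQUALITY + (L2ˢ).**  At K1's record provisos `Provisos₁₃SepCoPH`: the tree's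
selector laws (i)(ii) on the windowed runs' levels, and — the ONE analytic input, VERSION-FREE — the MEASURE INEQUALITY `hμUV` «`(avg_{k−1}∘⋯∘avg_0)_*(ρ₀·dU_0)(S) ≤ e^{ep(g_k)|T₁^{(k)}|}·Haar_k(S)`
for every measurable `S`» on the windowed runs (ultraviolet stability of the `k`-fold BLOCK-AVERAGED Wilson–Gibbs MEASURE: no density, no `Classical.choose` version, no everywhere bound, no
measurability row), (L2ˢ) ([III] Thm 2 ∕ (2.49) at the all-small history, pointwise as the engines carry it) and `εreg` in [Av] Prop. 2's range ⟹ for `dV`-a.e. `U` the two-sided (0.1) ∕ (2.50)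
bound on `ρ_k(U)`.  UPPER half: F12 §3 (`ρ_k·dV_k` IS that measure) + F12 §1's currency lemma; LOWER half (everywhere): dag-n13-w1's `uvLower_of_smallLocus`.  LOCATED: `hμUV` is (2.50)'s upper half
for the unrenormalised averaged measure — Bałaban's theorem proper at the tree's selector laws (print reaches it through the history-mixing 𝐑 of [IV]); displayed, NOT proved.  Nothing of
Bałaban's asserted. [cite: Balaban1989LargeFieldII, (0.1) pp.355–356; Balaban1988Convergent, Thm 2 p.263, (2.49)–(2.50) p.264, (3.1) p.264; Balaban1989LargeFieldI, (0.3) p.176, (i)–(ii) p.177, p.175; Balaban1985Averaging, Prop. 2 (54) p.26] -/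
theorem aeRow₁₃SepCoPH_of_selLaws_towerMeasureUV_L2small (hε : 0 < θ.ν.εreg) (hε3 : (143 * ((((4 + 4 : ℕ) : ℝ)) ^ 2 / 4) ^ 2) * θ.ν.εreg ≤ 1 / 3)
    (hε2 : 2 * θ.ν.εreg ≤ 2 * deltaSU (Fin N) / ((((4 + 4) * F.L : ℕ) : ℝ) ^ 2)) (γ : ℝ) (em ep : ℝ → ℝ)
    (hidem : ∀ (P : B12.RunParams) k, k < P.K → ∀ a, θ.ppSel P (gOfRecord₁₃ F N θ.toStage13Params P) (k + 1) (θ.ppSel P (gOfRecord₁₃ F N θ.toStage13Params P) (k + 1) a)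
      = θ.ppSel P (gOfRecord₁₃ F N θ.toStage13Params P) (k + 1) a)
    (hdead : ∀ (P : B12.RunParams) j, j < P.K → ∀ a : SeqOfRecord F θ.ν θ.τ9.M (gOfRecord₁₃ F N θ.toStage13Params P) P.K (j + 1),
      θ.ppSel P (gOfRecord₁₃ F N θ.toStage13Params P) (j + 1) a ≠ a →
      ∀ V, B15.BasicStep.fibreIntegral (fibOfSeq F θ.ν θ.τ9 P (gOfRecord₁₃ F N θ.toStage13Params P) (j + 1) a)
        (rterm (sliceOfRecord F N θ.ν θ.τ9.M P (gOfRecord₁₃ F N θ.toStage13Params P) (j + 1)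
          (slotsTOfRecord F N θ.ν θ.τ9 (EOfRecord₁₃ F N θ.toStage13Params) (wOfRecord₉ F N θ.toStage9Params) θ.ppSel P (gOfRecord₁₃ F N θ.toStage13Params P) (j + 1))) a) V = 0)
    (hμUV : ∀ P : B12.RunParams, ((datumOfRecord₁₃SepCoPH F N θ h).C P).flow.InInterval γ P.K → ∀ k, k ≤ P.K → ∀ S : Set (GaugeField (F.P P.K) k (SU N)), MeasurableSet S →
      ((fieldMeasure (F.P P.K) 0 (SU N)).withDensity fun U =>
          ENNReal.ofReal (rhoZeroOfRecord F N P.K (gOfRecord₁₃ F N θ.toStage13Params P 0) (EOfRecord₁₃ F N θ.toStage13Params P) U)).map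
        (Nat.rec (motive := fun j => GaugeField (F.P P.K) 0 (SU N) → GaugeField (F.P P.K) j (SU N)) id (fun j π => (avOfRecord F N P.K j).avg ∘ π) k) S ≤
      ENNReal.ofReal (Real.exp (ep (gOfRecord₁₃ F N θ.toStage13Params P k) * (Fintype.card (Site (F.P P.K) k) : ℝ))) * fieldMeasure (F.P P.K) k (SU N) S)
    (s₀ : (P : B12.RunParams) → (k : ℕ) → (reprOfRecord₁₃ F N θ.toStage13Params P k).Adm)
    (hL2small : ∀ P : B12.RunParams, ((datumOfRecord₁₃SepCoPH F N θ h).C P).flow.InInterval γ P.K → ∀ k, k ≤ P.K → SLaw₁₃CoPH F N θ P k →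
      ∀ V : GaugeField (F.P P.K) k (SU N),
        (∀ p : Plaq (F.P P.K) k, ¬ IsB0 (F := F) (⟨p.src, p.μ⟩ : PBond (F.P P.K) k) → ¬ IsB0 (F := F) (⟨p.src.shift p.μ, p.ν⟩ : PBond (F.P P.K) k) →
          ¬ IsB0 (F := F) (⟨p.src.shift p.ν, p.μ⟩ : PBond (F.P P.K) k) → ¬ IsB0 (F := F) (⟨p.src, p.ν⟩ : PBond (F.P P.K) k) →
          dist1 (GaugeField.plaqHol V p) < 2 * θ.ν.εreg + 4 * θ.ε₂₉) →
        chiβOfRecord₁₃ F N θ.toStage13Params P.K (gOfRecord₁₃ F N θ.toStage13Params P) k V *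
            Real.exp (-(1 / (gOfRecord₁₃ F N θ.toStage13Params P k) ^ 2 * wilsonBGOfRecord F N θ.εbg P k V)
              - em (gOfRecord₁₃ F N θ.toStage13Params P k) * (Fintype.card (Site (F.P P.K) k) : ℝ)) ≤
          (reprOfRecord₁₃ F N θ.toStage13Params P k).χ (s₀ P k) V * (reprOfRecord₁₃ F N θ.toStage13Params P k).TexpA (s₀ P k) V) :
    ∀ P : B12.RunParams, ((datumOfRecord₁₃SepCoPH F N θ h).C P).flow.InInterval γ P.K → ∀ k, k ≤ P.K → SLaw₁₃CoPH F N θ P k →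
      ∀ᵐ U ∂(fieldMeasure (F.P P.K) k (SU N)),
        chiβOfRecord₁₃ F N θ.toStage13Params P.K (gOfRecord₁₃ F N θ.toStage13Params P) k U *
              Real.exp (-(1 / (gOfRecord₁₃ F N θ.toStage13Params P k) ^ 2 * wilsonBGOfRecord F N θ.εbg P k U)
                - em (gOfRecord₁₃ F N θ.toStage13Params P k) * (Fintype.card (Site (F.P P.K) k) : ℝ)) ≤ densOfRecord₁₃ F N θ.toStage13Params P k U ∧
          densOfRecord₁₃ F N θ.toStage13Params P k U ≤ Real.exp (ep (gOfRecord₁₃ F N θ.toStage13Params P k) * (Fintype.card (Site (F.P P.K) k) : ℝ)) := by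
  intro P hP k hk hS
  -- UPPER half, a.e.: `ρ_k·dV_k` is the averaged Gibbs measure (F12 §3), bounded by `e^{ep|T|}·Haar` on sets (hμUV) ⟹ `ρ_k ≤ e^{ep|T|}` a.e. (F12 §1)
  have hρi : Integrable (densOfRecord₁₃ F N θ.toStage13Params P k) (fieldMeasure (F.P P.K) k (SU N)) :=
    isIntegrable_towerOfRecord₁₃SepCoPH F N θ h P k hk
  have hid := withDensity_densOfRecord₁₃_eq_map_tower_of_selLaws F N θ P h k hk
    (fun j hj => hidem P j (lt_of_lt_of_le hj hk)) (fun j hj => hdead P j (lt_of_lt_of_le hj hk))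
  have hup : ∀ᵐ U ∂(fieldMeasure (F.P P.K) k (SU N)),
      densOfRecord₁₃ F N θ.toStage13Params P k U ≤ Real.exp (ep (gOfRecord₁₃ F N θ.toStage13Params P k) * (Fintype.card (Site (F.P P.K) k) : ℝ)) :=
    (ae_le_iff_withDensity_le hρi.1.aemeasurable (ae_of_all _ fun U => densOfRecord₁₃_nonneg F N θ P h.toCore k U) _ (Real.exp_pos _).le).2
      fun S hSm => by rw [hid]; exact hμUV P hP k hk S hSm
  -- LOWER half, everywhere: (L2ˢ) through dag-n13-w1's `uvLower_of_smallLocus`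
  have hlow : ∀ U : GaugeField (F.P P.K) k (SU N),
      chiβOfRecord₁₃ F N θ.toStage13Params P.K (gOfRecord₁₃ F N θ.toStage13Params P) k U *
            Real.exp (-(1 / (gOfRecord₁₃ F N θ.toStage13Params P k) ^ 2 * wilsonBGOfRecord F N θ.εbg P k U)
              - em (gOfRecord₁₃ F N θ.toStage13Params P k) * (Fintype.card (Site (F.P P.K) k) : ℝ)) ≤ densOfRecord₁₃ F N θ.toStage13Params P k U :=
    uvLower_of_smallLocus θ.toStage13Params h.toCore.zetaUnity h.toCore.zetaAbs hε P (le_m_add_K_of_le (F := F) hk) hε3 hε2 _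
      (fun U hsmall => B14Cor3.ge_of_sum_repr
        (fun s => (reprOfRecord₁₃ F N θ.toStage13Params P k).χ s U * (reprOfRecord₁₃ F N θ.toStage13Params P k).TexpA s U) (s₀ P k)
        (densOfRecord₁₃_eq_sum F N θ P k U) (fun s => histTerm_nonneg θ.toStage13Params h.toCore.zetaUnity h.toCore.zetaAbs P k s U) (hL2small P hP k hk hS U hsmall))
  filter_upwards [hup] with U hU
  exact ⟨hlow U, hU⟩

end Row

/-! ## §2. ★★★ Composed with dag-n13-w2's p619268: Theorem 1 at the datum + the measure inequality + (L2ˢ) ⟹ (B) UP TO AN A.E. RE-CHOICE of the densities -/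

section UpToVersion

variable (F : T4Family) (N : ℕ) [NeZero N] (θ : Stage13HParams F N) (h : θ.Provisos₁₃SepCoPH F N)

open ExpMeanLog (deltaSU)
open Summit.QuantumFields.YangMills.BalabanUVNodes.N13Cor3AEIffUpToVersionAtRecord13 (exists_rho_ae_eq_endStatementBPrinted_datum_of_thm1_of_aeRow)
open B16RLeafRecord13SepCoPHSelLaws (thm1Printed_datumOfRecord₁₃SepCoPH_of_laws_of_selLaws)

open Classical in
/-- **★★★ K1's (B) AT ITS LITERAL DATUM UP TO A `dV`-A.E. RE-CHOICE OF THE DENSITIES, FROM THEOREM 1 THERE + ONE MEASURE INEQUALITY + (L2ˢ).**  `B16.Thm1Printed (datum).C`, the tree's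
selector laws (i)(ii), the MEASURE INEQUALITY `hμUV` on the `γ`-windowed runs (§1), (L2ˢ) and the ε-conditions ⟹ densities `ρ′ P k =ᵐ[dV] ρ_k` (every run and level) with
`B16.EndStatementBPrinted (fun P => {(datum).C P with ρ := ρ′ P})` AS TYPED — by dag-n13-w2's `exists_rho_ae_eq_endStatementBPrinted_datum_of_thm1_of_aeRow` (p619268) fed with §1.  This is the
B16-level half of plan g84 WORD-3b's (δⱽ) VERSION SLOT priced by an inequality between MEASURES: nothing in the analytic input reads a density version.  CONDITIONAL on the displayed inputs;
the datum-∕rung-level transfer (`Tower.revise`, `Revision₁₃`) is the definers'; nothing of Bałaban's asserted; K1⁸ NEITHER proved NOR refuted.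
[cite: Balaban1989LargeFieldII, Thm 1 p.355, (0.1) pp.355–356; Balaban1988Convergent, Thm 1 p.262, Thm 2 p.263, (2.49)–(2.50) p.264; Balaban1989LargeFieldI, (0.3) p.176, (i)–(ii) p.177] -/
theorem exists_rho_ae_eq_endStatementBPrinted_datum_of_thm1_of_towerMeasureUV_L2small (h1 : B16.Thm1Printed (datumOfRecord₁₃SepCoPH F N θ h).C)
    (hε : 0 < θ.ν.εreg) (hε3 : (143 * ((((4 + 4 : ℕ) : ℝ)) ^ 2 / 4) ^ 2) * θ.ν.εreg ≤ 1 / 3)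
    (hε2 : 2 * θ.ν.εreg ≤ 2 * deltaSU (Fin N) / ((((4 + 4) * F.L : ℕ) : ℝ) ^ 2)) {γ : ℝ} (hγ : 0 < γ) (em ep : ℝ → ℝ)
    (hidem : ∀ (P : B12.RunParams) k, k < P.K → ∀ a, θ.ppSel P (gOfRecord₁₃ F N θ.toStage13Params P) (k + 1) (θ.ppSel P (gOfRecord₁₃ F N θ.toStage13Params P) (k + 1) a)
      = θ.ppSel P (gOfRecord₁₃ F N θ.toStage13Params P) (k + 1) a)
    (hdead : ∀ (P : B12.RunParams) j, j < P.K → ∀ a : SeqOfRecord F θ.ν θ.τ9.M (gOfRecord₁₃ F N θ.toStage13Params P) P.K (j + 1),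
      θ.ppSel P (gOfRecord₁₃ F N θ.toStage13Params P) (j + 1) a ≠ a →
      ∀ V, B15.BasicStep.fibreIntegral (fibOfSeq F θ.ν θ.τ9 P (gOfRecord₁₃ F N θ.toStage13Params P) (j + 1) a)
        (rterm (sliceOfRecord F N θ.ν θ.τ9.M P (gOfRecord₁₃ F N θ.toStage13Params P) (j + 1)
          (slotsTOfRecord F N θ.ν θ.τ9 (EOfRecord₁₃ F N θ.toStage13Params) (wOfRecord₉ F N θ.toStage9Params) θ.ppSel P (gOfRecord₁₃ F N θ.toStage13Params P) (j + 1))) a) V = 0)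
    (hμUV : ∀ P : B12.RunParams, ((datumOfRecord₁₃SepCoPH F N θ h).C P).flow.InInterval γ P.K → ∀ k, k ≤ P.K → ∀ S : Set (GaugeField (F.P P.K) k (SU N)), MeasurableSet S →
      ((fieldMeasure (F.P P.K) 0 (SU N)).withDensity fun U =>
          ENNReal.ofReal (rhoZeroOfRecord F N P.K (gOfRecord₁₃ F N θ.toStage13Params P 0) (EOfRecord₁₃ F N θ.toStage13Params P) U)).map
        (Nat.rec (motive := fun j => GaugeField (F.P P.K) 0 (SU N) → GaugeField (F.P P.K) j (SU N)) id (fun j π => (avOfRecord F N P.K j).avg ∘ π) k) S ≤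
      ENNReal.ofReal (Real.exp (ep (gOfRecord₁₃ F N θ.toStage13Params P k) * (Fintype.card (Site (F.P P.K) k) : ℝ))) * fieldMeasure (F.P P.K) k (SU N) S)
    (s₀ : (P : B12.RunParams) → (k : ℕ) → (reprOfRecord₁₃ F N θ.toStage13Params P k).Adm)
    (hL2small : ∀ P : B12.RunParams, ((datumOfRecord₁₃SepCoPH F N θ h).C P).flow.InInterval γ P.K → ∀ k, k ≤ P.K → SLaw₁₃CoPH F N θ P k →
      ∀ V : GaugeField (F.P P.K) k (SU N),
        (∀ p : Plaq (F.P P.K) k, ¬ IsB0 (F := F) (⟨p.src, p.μ⟩ : PBond (F.P P.K) k) → ¬ IsB0 (F := F) (⟨p.src.shift p.μ, p.ν⟩ : PBond (F.P P.K) k) →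
          ¬ IsB0 (F := F) (⟨p.src.shift p.ν, p.μ⟩ : PBond (F.P P.K) k) → ¬ IsB0 (F := F) (⟨p.src, p.ν⟩ : PBond (F.P P.K) k) →
          dist1 (GaugeField.plaqHol V p) < 2 * θ.ν.εreg + 4 * θ.ε₂₉) →
        chiβOfRecord₁₃ F N θ.toStage13Params P.K (gOfRecord₁₃ F N θ.toStage13Params P) k V *
            Real.exp (-(1 / (gOfRecord₁₃ F N θ.toStage13Params P k) ^ 2 * wilsonBGOfRecord F N θ.εbg P k V)
              - em (gOfRecord₁₃ F N θ.toStage13Params P k) * (Fintype.card (Site (F.P P.K) k) : ℝ)) ≤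
          (reprOfRecord₁₃ F N θ.toStage13Params P k).χ (s₀ P k) V * (reprOfRecord₁₃ F N θ.toStage13Params P k).TexpA (s₀ P k) V) :
    ∃ ρ' : (P : B12.RunParams) → (k : ℕ) → GaugeField (F.P P.K) k (SU N) → ℝ,
      (∀ P k, ρ' P k =ᵐ[fieldMeasure (F.P P.K) k (SU N)] densOfRecord₁₃ F N θ.toStage13Params P k) ∧
        B16.EndStatementBPrinted (fun P => { (datumOfRecord₁₃SepCoPH F N θ h).C P with ρ := ρ' P }) :=
  exists_rho_ae_eq_endStatementBPrinted_datum_of_thm1_of_aeRow F N θ h h1 hγ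
    (aeRow₁₃SepCoPH_of_selLaws_towerMeasureUV_L2small F N θ h hε hε3 hε2 γ em ep hidem hdead hμUV s₀ hL2small)

open Classical in
/-- **★★★ THE SAME WITH THEOREM 1 FROM N11's T-ROW + THE SELECTOR LAWS** (p583899's `thm1Printed_datumOfRecord₁₃SepCoPH_of_laws_of_selLaws` — the SAME `hidem`∕`hdead` serving Theorem 1's 𝐑-leaf and
the measure road): (B) at K1's literal datum UP TO AN A.E. RE-CHOICE ⟸ admissibility ∧ signs ∧ selector laws (i)(ii) ∧ N11's T-row `hT` ∧ the MEASURE INEQUALITY `hμUV` ∧ (L2ˢ) ∧ ε.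
DISPLAYED (LOCATED): `hμUV` = UV stability of the averaged Gibbs MEASURE (Bałaban's theorem proper at the tree's selector laws); `hT` = N11; (L2ˢ) = [III] Thm 2 at the all-small history;
selector laws = [IV] p.177 (i)–(ii) as typed.  Nothing of Bałaban's asserted; K1⁸ NEITHER proved NOR refuted; N13 NOT discharged.
[cite: Balaban1989LargeFieldII, Thm 1 p.355, (0.1) pp.355–356; Balaban1988Convergent, Thm 1 p.262, Thm 2 p.263, (2.49)–(2.50) p.264; Balaban1989LargeFieldI, (0.3) p.176, (i)–(ii) p.177] -/
theorem exists_rho_ae_eq_endStatementBPrinted_datum_of_tRow_selLaws_towerMeasureUV_L2small (hθ : θ.Admissible F N) (hκ : 0 ≤ θ.s2.lf.κ) (hE₀ : 0 ≤ θ.s2.lf.E₀)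
    (hB₀ : 0 ≤ θ.s2.lf.B₀) (hε : 0 < θ.ν.εreg) (hε3 : (143 * ((((4 + 4 : ℕ) : ℝ)) ^ 2 / 4) ^ 2) * θ.ν.εreg ≤ 1 / 3)
    (hε2 : 2 * θ.ν.εreg ≤ 2 * deltaSU (Fin N) / ((((4 + 4) * F.L : ℕ) : ℝ) ^ 2)) {γ : ℝ} (hγ : 0 < γ) (em ep : ℝ → ℝ)
    (hidem : ∀ (P : B12.RunParams) k, k < P.K → ∀ a, θ.ppSel P (gOfRecord₁₃ F N θ.toStage13Params P) (k + 1) (θ.ppSel P (gOfRecord₁₃ F N θ.toStage13Params P) (k + 1) a)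
      = θ.ppSel P (gOfRecord₁₃ F N θ.toStage13Params P) (k + 1) a)
    (hdead : ∀ (P : B12.RunParams) j, j < P.K → ∀ a : SeqOfRecord F θ.ν θ.τ9.M (gOfRecord₁₃ F N θ.toStage13Params P) P.K (j + 1),
      θ.ppSel P (gOfRecord₁₃ F N θ.toStage13Params P) (j + 1) a ≠ a →
      ∀ V, B15.BasicStep.fibreIntegral (fibOfSeq F θ.ν θ.τ9 P (gOfRecord₁₃ F N θ.toStage13Params P) (j + 1) a)
        (rterm (sliceOfRecord F N θ.ν θ.τ9.M P (gOfRecord₁₃ F N θ.toStage13Params P) (j + 1)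
          (slotsTOfRecord F N θ.ν θ.τ9 (EOfRecord₁₃ F N θ.toStage13Params) (wOfRecord₉ F N θ.toStage9Params) θ.ppSel P (gOfRecord₁₃ F N θ.toStage13Params P) (j + 1))) a) V = 0)
    (hμUV : ∀ P : B12.RunParams, ((datumOfRecord₁₃SepCoPH F N θ h).C P).flow.InInterval γ P.K → ∀ k, k ≤ P.K → ∀ S : Set (GaugeField (F.P P.K) k (SU N)), MeasurableSet S →
      ((fieldMeasure (F.P P.K) 0 (SU N)).withDensity fun U =>
          ENNReal.ofReal (rhoZeroOfRecord F N P.K (gOfRecord₁₃ F N θ.toStage13Params P 0) (EOfRecord₁₃ F N θ.toStage13Params P) U)).map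
        (Nat.rec (motive := fun j => GaugeField (F.P P.K) 0 (SU N) → GaugeField (F.P P.K) j (SU N)) id (fun j π => (avOfRecord F N P.K j).avg ∘ π) k) S ≤
      ENNReal.ofReal (Real.exp (ep (gOfRecord₁₃ F N θ.toStage13Params P k) * (Fintype.card (Site (F.P P.K) k) : ℝ))) * fieldMeasure (F.P P.K) k (SU N) S)
    (s₀ : (P : B12.RunParams) → (k : ℕ) → (reprOfRecord₁₃ F N θ.toStage13Params P k).Adm)
    (hT : ∀ P : B12.RunParams, ((datumOfRecord₁₃SepCoPH F N θ h).C P).flow.InInterval γ P.K →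
      ∀ k, k < P.K → SLaw₁₃CoPH F N θ P k → TLaw₁₃CoPH F N θ P k)
    (hL2small : ∀ P : B12.RunParams, ((datumOfRecord₁₃SepCoPH F N θ h).C P).flow.InInterval γ P.K → ∀ k, k ≤ P.K → SLaw₁₃CoPH F N θ P k →
      ∀ V : GaugeField (F.P P.K) k (SU N),
        (∀ p : Plaq (F.P P.K) k, ¬ IsB0 (F := F) (⟨p.src, p.μ⟩ : PBond (F.P P.K) k) → ¬ IsB0 (F := F) (⟨p.src.shift p.μ, p.ν⟩ : PBond (F.P P.K) k) →
          ¬ IsB0 (F := F) (⟨p.src.shift p.ν, p.μ⟩ : PBond (F.P P.K) k) → ¬ IsB0 (F := F) (⟨p.src, p.ν⟩ : PBond (F.P P.K) k) →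
          dist1 (GaugeField.plaqHol V p) < 2 * θ.ν.εreg + 4 * θ.ε₂₉) →
        chiβOfRecord₁₃ F N θ.toStage13Params P.K (gOfRecord₁₃ F N θ.toStage13Params P) k V *
            Real.exp (-(1 / (gOfRecord₁₃ F N θ.toStage13Params P k) ^ 2 * wilsonBGOfRecord F N θ.εbg P k V)
              - em (gOfRecord₁₃ F N θ.toStage13Params P k) * (Fintype.card (Site (F.P P.K) k) : ℝ)) ≤
          (reprOfRecord₁₃ F N θ.toStage13Params P k).χ (s₀ P k) V * (reprOfRecord₁₃ F N θ.toStage13Params P k).TexpA (s₀ P k) V) :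
    ∃ ρ' : (P : B12.RunParams) → (k : ℕ) → GaugeField (F.P P.K) k (SU N) → ℝ,
      (∀ P k, ρ' P k =ᵐ[fieldMeasure (F.P P.K) k (SU N)] densOfRecord₁₃ F N θ.toStage13Params P k) ∧
        B16.EndStatementBPrinted (fun P => { (datumOfRecord₁₃SepCoPH F N θ h).C P with ρ := ρ' P }) :=
  exists_rho_ae_eq_endStatementBPrinted_datum_of_thm1_of_towerMeasureUV_L2small F N θ h
    (thm1Printed_datumOfRecord₁₃SepCoPH_of_laws_of_selLaws F N θ h hθ hκ hE₀ hB₀ hγ hidem hdead hT) hε hε3 hε2 hγ em ep hidem hdead hμUV s₀ hL2small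

end UpToVersion

/-! ## §3. ★★★ THE K1⁹ (B)-SLOT LETTER `∃ v : Revision₁₃ F N θ h, B16.EndStatementBPrinted (datumOfRecord₁₃SepCoPHV F N θ h v).C` from Theorem 1 + the level-0 row + ONE MEASURE INEQUALITY at levels ≥ 1 + the a.e. (Lˢ) half (dag-n13-w2's p621421 §4 fed) -/

section Slot

variable (F : T4Family) (N : ℕ) [NeZero N] (θ : Stage13HParams F N) (h : θ.Provisos₁₃SepCoPH F N)

open ExpMeanLog (deltaSU)
open Summit.QuantumFields.YangMills.BalabanUVNodes.N13Cor3AEKeepZeroOfEnginesRowAtRecord13 (exists_revision₁₃_endStatementBPrinted_of_thm1_of_row0_of_aeUpper_of_aeLowerSmall)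

open Classical in
/-- **★★★ THE REVISED (B)-CONJUNCT OF K1 AT ITS RECORD — plan g84 WORD-3b's (δⱽ) VERSION-SLOT LETTER — WITH ITS UPPER HALF PRICED BY ONE INEQUALITY BETWEEN MEASURES.**  Theorem 1 at the datum,
the level-0 row `hrow0` (two-sided (2.50) at `k = 0` at every field — dag-n13-w1's level-0 editions discharge it at the K0-class witnesses), the tree's selector laws (i)(ii), the MEASURE
INEQUALITY `hμUV` «`(π_{k+1})_*(ρ₀·dU_0)(S) ≤ ofReal (e^{ep(g_{k+1})|T₁^{(k+1)}|}) · Haar_{k+1}(S)`» on the `γ`-windowed runs' levels `k + 1 ≤ K`, and the `dV`-a.e. LOWER half on the small locus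
`hlowerSmall` (dag-n13-w2's letter, p621421; the (L2ˢ)-type input of the n13 lanes) ⟹ `∃ v : Revision₁₃ F N θ h, B16.EndStatementBPrinted (datumOfRecord₁₃SepCoPHV F N θ h v).C` — BY NAME
p621421 §4 `exists_revision₁₃_endStatementBPrinted_of_thm1_of_row0_of_aeUpper_of_aeLowerSmall` with its `hupper` DISCHARGED from `hμUV` through §0 (`ρ_{k+1}·dV IS (π_{k+1})_*(ρ₀·dU)` under the
laws).  So the K1⁹ (B)-slot's ONE open analytic entry at levels ≥ 1 (dag-n13-w1 CLAIM-4's census) reads, on the upper side, as ultraviolet stability of the block-averaged Wilson–Gibbs MEASURE —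
no density version anywhere.  CONDITIONAL on the displayed inputs (nobody's theorem here); nothing of Bałaban's asserted; K1⁸∕K1⁹ NEITHER proved NOR refuted; N13 NOT discharged.
[cite: Balaban1989LargeFieldII, Thm 1 p.355, (0.1) pp.355–356; Balaban1988Convergent, Thm 1 p.262, Thm 2 p.263, (2.49)–(2.50) p.264, (3.1) p.264; Balaban1989LargeFieldI, (0.2)–(0.4) p.176, (i)–(ii) p.177; Balaban1987RG1, (0.4) p.253] -/
theorem exists_revision₁₃_endStatementBPrinted_of_thm1_of_row0_of_towerMeasureUV_of_aeLowerSmall (hε : 0 < θ.ν.εreg)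
    (hε3 : (143 * ((((4 + 4 : ℕ) : ℝ)) ^ 2 / 4) ^ 2) * θ.ν.εreg ≤ 1 / 3) (hε2 : 2 * θ.ν.εreg ≤ 2 * deltaSU (Fin N) / ((((4 + 4) * F.L : ℕ) : ℝ) ^ 2))
    (h1 : B16.Thm1Printed (datumOfRecord₁₃SepCoPH F N θ h).C) {γ : ℝ} (hγ : 0 < γ) {em ep : ℝ → ℝ}
    (hidem : ∀ (P : B12.RunParams) k, k < P.K → ∀ a, θ.ppSel P (gOfRecord₁₃ F N θ.toStage13Params P) (k + 1) (θ.ppSel P (gOfRecord₁₃ F N θ.toStage13Params P) (k + 1) a)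
      = θ.ppSel P (gOfRecord₁₃ F N θ.toStage13Params P) (k + 1) a)
    (hdead : ∀ (P : B12.RunParams) j, j < P.K → ∀ a : SeqOfRecord F θ.ν θ.τ9.M (gOfRecord₁₃ F N θ.toStage13Params P) P.K (j + 1),
      θ.ppSel P (gOfRecord₁₃ F N θ.toStage13Params P) (j + 1) a ≠ a →
      ∀ V, B15.BasicStep.fibreIntegral (fibOfSeq F θ.ν θ.τ9 P (gOfRecord₁₃ F N θ.toStage13Params P) (j + 1) a)
        (rterm (sliceOfRecord F N θ.ν θ.τ9.M P (gOfRecord₁₃ F N θ.toStage13Params P) (j + 1)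
          (slotsTOfRecord F N θ.ν θ.τ9 (EOfRecord₁₃ F N θ.toStage13Params) (wOfRecord₉ F N θ.toStage9Params) θ.ppSel P (gOfRecord₁₃ F N θ.toStage13Params P) (j + 1))) a) V = 0)
    (hrow0 : ∀ P : B12.RunParams, ((datumOfRecord₁₃SepCoPH F N θ h).C P).flow.InInterval γ P.K → SLaw₁₃CoPH F N θ P 0 →
      ∀ U : GaugeField (F.P P.K) 0 (SU N),
        chiβOfRecord₁₃ F N θ.toStage13Params P.K (gOfRecord₁₃ F N θ.toStage13Params P) 0 U *
              Real.exp (-(1 / (gOfRecord₁₃ F N θ.toStage13Params P 0) ^ 2 * wilsonBGOfRecord F N θ.εbg P 0 U)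
                - em (gOfRecord₁₃ F N θ.toStage13Params P 0) * (Fintype.card (Site (F.P P.K) 0) : ℝ)) ≤ densOfRecord₁₃ F N θ.toStage13Params P 0 U ∧
          densOfRecord₁₃ F N θ.toStage13Params P 0 U ≤ Real.exp (ep (gOfRecord₁₃ F N θ.toStage13Params P 0) * (Fintype.card (Site (F.P P.K) 0) : ℝ)))
    (hμUV : ∀ P : B12.RunParams, ((datumOfRecord₁₃SepCoPH F N θ h).C P).flow.InInterval γ P.K → ∀ k, k + 1 ≤ P.K → ∀ S : Set (GaugeField (F.P P.K) (k + 1) (SU N)), MeasurableSet S →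
      ((fieldMeasure (F.P P.K) 0 (SU N)).withDensity fun U =>
          ENNReal.ofReal (rhoZeroOfRecord F N P.K (gOfRecord₁₃ F N θ.toStage13Params P 0) (EOfRecord₁₃ F N θ.toStage13Params P) U)).map
        (Nat.rec (motive := fun j => GaugeField (F.P P.K) 0 (SU N) → GaugeField (F.P P.K) j (SU N)) id (fun j π => (avOfRecord F N P.K j).avg ∘ π) (k + 1)) S ≤
      ENNReal.ofReal (Real.exp (ep (gOfRecord₁₃ F N θ.toStage13Params P (k + 1)) * (Fintype.card (Site (F.P P.K) (k + 1)) : ℝ))) * fieldMeasure (F.P P.K) (k + 1) (SU N) S)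
    (hlowerSmall : ∀ P : B12.RunParams, ((datumOfRecord₁₃SepCoPH F N θ h).C P).flow.InInterval γ P.K → ∀ k, k + 1 ≤ P.K → SLaw₁₃CoPH F N θ P (k + 1) →
      ∀ᵐ U ∂(fieldMeasure (F.P P.K) (k + 1) (SU N)),
        (∀ p : Plaq (F.P P.K) (k + 1), ¬ IsB0 (F := F) (⟨p.src, p.μ⟩ : PBond (F.P P.K) (k + 1)) → ¬ IsB0 (F := F) (⟨p.src.shift p.μ, p.ν⟩ : PBond (F.P P.K) (k + 1)) →
          ¬ IsB0 (F := F) (⟨p.src.shift p.ν, p.μ⟩ : PBond (F.P P.K) (k + 1)) → ¬ IsB0 (F := F) (⟨p.src, p.ν⟩ : PBond (F.P P.K) (k + 1)) →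
          dist1 (GaugeField.plaqHol U p) < 2 * θ.ν.εreg + 4 * θ.ε₂₉) →
        chiβOfRecord₁₃ F N θ.toStage13Params P.K (gOfRecord₁₃ F N θ.toStage13Params P) (k + 1) U *
            Real.exp (-(1 / (gOfRecord₁₃ F N θ.toStage13Params P (k + 1)) ^ 2 * wilsonBGOfRecord F N θ.εbg P (k + 1) U)
              - em (gOfRecord₁₃ F N θ.toStage13Params P (k + 1)) * (Fintype.card (Site (F.P P.K) (k + 1)) : ℝ)) ≤ densOfRecord₁₃ F N θ.toStage13Params P (k + 1) U) :
    ∃ v : Revision₁₃ F N θ h, B16.EndStatementBPrinted (datumOfRecord₁₃SepCoPHV F N θ h v).C :=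
  exists_revision₁₃_endStatementBPrinted_of_thm1_of_row0_of_aeUpper_of_aeLowerSmall F N θ h hε hε3 hε2 h1 hγ hrow0
    (fun P hP k hk _ => (towerMeasure_le_iff_ae_densOfRecord₁₃_le F N θ P h (k + 1) hk
      (fun j hj => hidem P j (lt_of_lt_of_le hj hk)) (fun j hj => hdead P j (lt_of_lt_of_le hj hk)) _ (Real.exp_pos _).le).1 (hμUV P hP k hk))
    hlowerSmall

end Slot





end Summit.QuantumFields.YangMills.BalabanUVNodes.N13AERowOfAveragedGibbsMeasureBoundAtRecord13SepCoPH

end
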